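import Summits.BirchSwinnertonDyer.BirchSwinnertonDyer.Theorems.QuadraticBranchSignedControlPlusEtaNonsurjTamagawaDichotomyEta
import Mathlib.RingTheory.PowerSeries.Ideal
import Mathlib.RingTheory.PowerSeries.NoZeroDivisors
import HarnessLib

/-!
# Route `QuadraticBranchSignedControl` (rung K8, cell `bsd-potss`), residual crux
# `PlusEtaMainConjectureNonsurj` (stmt-BirchSwinnertonDyer-19606): the PRIME-`L`-FUNCTION ROAD — on a
# row where `L_p⁺(V,η,X)` is a PRIME element of `Λ = ℤ_p⟦T⟧` and `Sel_{p^∞}(W/ℚ)` is INFINITE (the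
# rank-`1` rows), Kobayashi's even main conjecture at `η` IS `μ(X⁺(V/K_∞)^η) = 0` — image-free,
# Poitou–Tate-free, with NO leading-term / `BSD_p` / 19116 input (seat `bsd-potss-k8eta-c2` g4)

WHAT. The rows of crux 19606 are the good supersingular `a_p = 0` twists `V = W^{(p*)}`, `p ≥ 5`, whose
`p`-adic tower is NOT onto (CM, or image `C_ns⁺(p)` exactly — g0 p448914). Skeleton v3 (planner g18)
reduced its RANK-`0` rows to `stub_etaMC_r0_mu` (`μ(X⁺(V/K_∞)^η) = 0`) + (L₀ | bsd.S28) through seat g2's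
`μ`-road and ctrl g4's converse roads; the RANK-`1` rows (below `5·10⁵`: 290 = 274 CM + 16 non-CM, seat g3's
census) were untouched. THIS FILE gives the rank-`≥ 1` twin with LESS input. The mechanism is three
lines of algebra in the UFD `Λ`:

* Kobayashi's Thm. 4.1 at `η`, RATIONAL clause (tree fact `thm41_plusEtaCharIdeal_dvd`, first display, NO
  image hypothesis): a characteristic generator `g` of `X⁺(V/K_∞)^η` divides `pⁿ·L_η`;
* `μ = 0` (`p ∤ g`, Greenberg–Vatsal's unit content) + Gauss' lemma for the prime `p ∈ Λ`: `g ∣ L_η`;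
* **if `L_η` is PRIME in `Λ`, then `g ∈ Λˣ` or `(g) = (L_η)`** — and `g ∉ Λˣ` as soon as `T ∣ g`, which the
  bottom layer forces when `Sel_{p^∞}(W/ℚ)` is infinite (`g(0) ≠ 0 ⟹ A₀⁺` finite ⟹ `Sel⁺(W/ℚ_0)` finite,
  the tree's `EvenControlZero.finite_localPreimage_of_constantCoeff_ne_zero` + g2's
  `EtaBottomLayer.layer_le_localPreimage`, both `hnf`-free and Poitou–Tate-free).

So on every row with `Sel_{p^∞}(W/ℚ)` infinite and `L_p⁺(V,η,X)` prime — in particular on every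
analytic-rank-`1` row whose `η`-branch plus `p`-adic `L`-function has Iwasawa invariants
`(λ, μ) = (1, 0)`, i.e. `(L_p⁺(V,η,X)) = (X)` (seat g3's PARI census: 254 of the 290 rank-`1` non-onto
rows below `5·10⁵`, among them ALL 9 non-CM rows with a CM unit anchor) — **(C1⁺_η)(V,p) ⟸ `μ(X⁺(V/K_∞)^η) = 0`
+ Thm. 2.2η + Thm. 4.1η (rational)**, and conversely (C1⁺_η) at a datum with `(L_η) = (X)` trivially gives
unit content. No Perrin-Riou / `p`-adic Gross–Zagier (19116), no `BSD_p(W)`, no Kitajima–Otsuki, no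
Poitou–Tate, no L₀, no image hypothesis enter.

* §1 `Λ`-algebra: `prime_of_span_eq_span_X`, `span_eq_span_of_prime_of_hasUnitContent_of_dvd` (the three lines
  above), `ideal_eq_span_iff_forall_hasUnitContent_of_span_eq_span_X` (at a datum: MC ⟺ `μ = 0`).
* §2 `W`-side bottom layer: `constantCoeff_charGenerator_eq_zero_of_not_finite_selmer`; `Sel_{p^∞}(W/ℚ)`
  infinite from `rank W(ℚ) ≠ 0` / `r_an(W) = 1` (corank identity, GZK).
* §3 `η`-side through ctrl g4's (D5⁺)⁻¹: **`quadraticBranchPlusEtaMainConjectureAt_of_prime_of_hasUnitContent`**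
  (the road at a pair); `…_of_span_eq_span_X_of_hasUnitContent` (the `λ = 1` shape); the stub-shaped ∀-form
  `etaMC_rankOneRows_of_mu_eq_zero_of_span_eq_span_X` (analytic rank `1` via GZK).

HONEST FRAMING (cell `bsd-potss`, run/shared/lean/pub/bsd-potss/; FULL-BSD rank ≤ 1 programme,
tranche 1b, HUMAN RULING D-0036/D-0074): BOOKKEEPING / TOOL THEOREMS ONLY — no definition, no named
Literature fact minted, no Summits-side `def … : Prop`, no `sorry`, axioms standard. CONDITIONAL on the
DISPLAYED binders `μ(X⁺(V/K_∞)^η) = 0` (open in general — for CM `V` Pollack–Rubin's remark p. 448; for the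
unit-anchored non-CM rows Hatley–Lei 2019 Thm. 4.6, seat g3's `EtaCongruentAnchor`) and the SHAPE of
`L_p⁺(V,η,X)` (prime / `= (X)`: an ANALYTIC input, certified per row by PARI's `ellpadiclambdamu`, not a
kernel theorem), and on Kobayashi 2003 Thm. 2.2 / Thm. 4.1 (rational clause) at `η` + GZK (named facts,
hypothesis position). No stub of 19606 is proved by name; the crux stays OPEN; nothing is booked; no label /
mark / count moves; `BSD(W,p)` is claimed for no pair. `--supports stmt-BirchSwinnertonDyer-19606`.

References: [Kobayashi2003] Thm. 2.2 (p. 5), §4 Even main conjecture + Thm. 4.1 first display (p. 8), Lemma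
9.1 (p. 25), Thm. 9.3 with (9.33) (pp. 26–27); [GreenbergLNM1716] §3 Lemma 3.1–3.3, §4 Lemma 4.2 (p. 102);
[GreenbergVatsal2000] p. 2 (2); [Washington1997] §7.1 (units of `Λ`), §13.1; [PollackRubin2004] remark
p. 448; [HatleyLei2019] Thm. 4.6; [Pollack2003] Thm. 5.1 / §6 (the invariants `λ^±`, `μ^±`; shape only).
-/

set_option autoImplicit false
set_option linter.dupNamespace false

noncomputable section

open scoped Classical

open CongruenceSubgroup Field Function NumberField IsDedekindDomain WeierstrassCurve
open Literature.NumberTheory.EllipticCurves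
open Literature.NumberTheory.EllipticCurves.ModularForms
open Literature.NumberTheory.EllipticCurves.Rank1Residual
open Literature.NumberTheory.EllipticCurves.Rank1Residual.Typed
open Literature.NumberTheory.GaloisRepresentations
open Literature.NumberTheory.GaloisCohomology
open Literature.NumberTheory.EllipticCurves.IwasawaAlgebra
open Literature.NumberTheory.EllipticCurves.IwasawaDual ZpExtension
open Literature.NumberTheory.EllipticCurves.GreenbergVatsal2000
open Summit.BirchSwinnertonDyer.Rank1Residual.X11b.Levels
open Summit.BirchSwinnertonDyer.Rank1Residual.X11b
open Summit.BirchSwinnertonDyer.Rank1Residual.Additive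
open Summit.BirchSwinnertonDyer.Rank1Residual.Additive.SignedTwist
open scoped ContRepresentation
open Summit.BirchSwinnertonDyer.Rank1Residual.AdditivePotMult

namespace Summit.BirchSwinnertonDyer.BirchSwinnertonDyer.Theorems

namespace EtaPrimeRoad

/-! ## §1 `Λ`-algebra: prime elements of `Λ = ℤ_p⟦T⟧` and the three-line road -/

section Algebra

variable {p : ℕ} [hp : Fact p.Prime]

/-- **`(L) = (X) ⟹ L` is a PRIME element of `Λ`** (`X = T` is prime in the power series ring over the
domain `ℤ_p`, and primality passes to associates). The shape of `L_p⁺(V,η,X)` with Iwasawa invariants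
`(λ, μ) = (1, 0)` and `L(0) = 0` — the analytic-rank-`1` rows of crux 19606 in PARI's census.
[cite: Washington1997, §7.1 and §13.1] -/
theorem prime_of_span_eq_span_X {L : IwasawaAlgebra p}
    (h : Ideal.span ({L} : Set (IwasawaAlgebra p)) = Ideal.span {PowerSeries.X}) : Prime L :=
  (Ideal.span_singleton_eq_span_singleton.mp h).symm.prime PowerSeries.X_prime

/-- `X = T ∈ Λ` has unit content (its degree-`1` coefficient is `1`). [cite: GreenbergVatsal2000, p. 2 (2)] -/
theorem hasUnitContent_X : HasUnitContent (PowerSeries.X : IwasawaAlgebra p) :=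
  ⟨1, by rw [PowerSeries.coeff_one_X]; exact isUnit_one⟩

/-- `(g) = (X) ⟹ g` has unit content (unit content is an invariant of the ideal). The converse
direction of the road at a datum: (C1⁺_η) with `(L_η) = (X)` gives `μ = 0` outright.
[cite: GreenbergVatsal2000, p. 2 (2)] -/
theorem hasUnitContent_of_span_eq_span_X {g : IwasawaAlgebra p}
    (h : Ideal.span ({g} : Set (IwasawaAlgebra p)) = Ideal.span {PowerSeries.X}) : HasUnitContent g :=
  (hasUnitContent_congr_of_span_eq h).mpr hasUnitContent_X

/-- **THE THREE-LINE ROAD.** In `Λ = ℤ_p⟦T⟧`: `L` prime, `g` of unit content (`p ∤ g`, `μ = 0`),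
`g ∣ pⁿ·L` (Kobayashi's Thm. 4.1, rational clause) and `g ∉ Λˣ` ⟹ `(g) = (L)`. Gauss' lemma for the prime
`p ∈ Λ` (`dvd_of_dvd_C_pow_mul_of_hasUnitContent`) gives `g ∣ L`, and a non-unit divisor of a prime is an
associate. [cite: Washington1997, §7.1 and §13.1] [cite: Kobayashi2003, Thm. 4.1 first display (p. 8)]
[cite: GreenbergVatsal2000, p. 2 (2)] -/
theorem span_eq_span_of_prime_of_hasUnitContent_of_dvd {g L : IwasawaAlgebra p} (hL : Prime L)
    (hu : HasUnitContent g) (n : ℕ) (hdvd : g ∣ PowerSeries.C ((p : ℤ_[p]) ^ n) * L)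
    (hg : ¬ IsUnit g) : Ideal.span ({g} : Set (IwasawaAlgebra p)) = Ideal.span {L} := by
  obtain ⟨h, hh⟩ := dvd_of_dvd_C_pow_mul_of_hasUnitContent hu n hdvd
  rcases hL.irreducible.isUnit_or_isUnit hh with hgU | hhU
  · exact absurd hgU hg
  · exact Ideal.span_singleton_eq_span_singleton.mpr ⟨hhU.unit, by rw [IsUnit.unit_spec, hh]⟩

/-- `g(0) = 0 ⟹ g ∉ Λˣ` (a unit power series has a unit constant term). [cite: Washington1997, §7.1] -/
theorem not_isUnit_of_constantCoeff_eq_zero {g : IwasawaAlgebra p} (h0 : PowerSeries.constantCoeff g = 0) :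
    ¬ IsUnit g := fun hU ↦ by
  have h := PowerSeries.isUnit_iff_constantCoeff.mp hU
  rw [h0] at h
  exact not_isUnit_zero h

/-- **At a datum, the even main conjecture IS `μ = 0` (when `(L) = (X)`, `T ∣ Char` and `pⁿ·L ∈ Char`).**
For an ideal `I ⊆ Λ` (the characteristic ideal of an `η`-datum: principal, `Λ` being a UFD) with
`pⁿ·L ∈ I` (Thm. 4.1η, rational clause), every generator vanishing at `T = 0` (the rank-`≥ 1` bottom
layer, §2–§3) and `(L) = (X)` (the `λ = 1` shape): `I = (L)` iff every generator of `I` has unit content.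
`→`: unit content is an invariant of the ideal and `X` has it; `←`: the three-line road.
[cite: Kobayashi2003, §4 Even main conjecture and Thm. 4.1 first display (p. 8)] [cite: GreenbergVatsal2000, p. 2 (2)] -/
theorem ideal_eq_span_iff_forall_hasUnitContent_of_span_eq_span_X {I : Ideal (IwasawaAlgebra p)}
    (hI : I.IsPrincipal) {L : IwasawaAlgebra p}
    (hLX : Ideal.span ({L} : Set (IwasawaAlgebra p)) = Ideal.span {PowerSeries.X})
    {n : ℕ} (hn : PowerSeries.C ((p : ℤ_[p]) ^ n) * L ∈ I)
    (h0 : ∀ g : IwasawaAlgebra p, I = Ideal.span {g} → PowerSeries.constantCoeff g = 0) :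
    I = Ideal.span {L} ↔ ∀ g : IwasawaAlgebra p, I = Ideal.span {g} → HasUnitContent g := by
  refine ⟨fun h g hg ↦ hasUnitContent_of_span_eq_span_X ((h.symm.trans hg).symm.trans hLX), fun H ↦ ?_⟩
  obtain ⟨g, hg⟩ := hI.principal
  have hg' : I = Ideal.span {g} := hg
  rw [hg', Ideal.mem_span_singleton] at hn
  rw [hg']
  exact span_eq_span_of_prime_of_hasUnitContent_of_dvd (prime_of_span_eq_span_X hLX) (H g hg') n hn
    (not_isUnit_of_constantCoeff_eq_zero (h0 g hg'))

end Algebra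

/-! ## §2 `W`-side: `Sel_{p^∞}(W/ℚ)` infinite ⟹ `T ∣ g` for every plus dual datum of `Sel⁺(W/ℚ_∞)` -/

section Twist

variable {p : ℕ} [hp : Fact p.Prime] (κ : ZpExtension ℚ p) (W : WeierstrassCurve ℚ) [W.IsElliptic]

/-- **`Sel_{p^∞}(W/ℚ)` infinite ⟹ `g(0) = 0` for every characteristic generator `g` of every torsion
plus dual datum of `Sel⁺(W/ℚ_∞)`** (`W` globally minimal the `p*`-twist partner of a globally minimal good
`a_p = 0` curve `V`, `p` odd, `κ` a `ℤ_p`-extension with topological generator `γ`). Contrapositive of the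
bottom layer: `g(0) ≠ 0 ⟹ X/TX` finite ⟹ `(Sel⁺_∞)^Γ` finite ⟹ `A₀⁺ = h₀⁻¹(Sel⁺_∞)` finite (the tree's
`EvenControlZero.finite_localPreimage_of_constantCoeff_ne_zero`, Kobayashi Lemma 9.1 / `W(ℚ_∞)[p^∞] = 0`
for the twist) ⟹ `Sel⁺(W/ℚ_0) ≤ A₀⁺` finite (g2's `EtaBottomLayer.layer_le_localPreimage`) ⟹
`Sel_{p^∞}(W/ℚ)` finite (`#Sel⁺(W/ℚ_0) = #Sel_{p^∞}(W/ℚ)`). No finite-submodule hypothesis, no Poitou–Tate,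
no image hypothesis. [cite: Kobayashi2003, Lemma 9.1 (p. 25), Thm. 9.3 with (9.33) (pp. 26–27)]
[cite: GreenbergLNM1716, §3 Lemma 3.1, §4 Lemma 4.2 (p. 102)] -/
theorem constantCoeff_charGenerator_eq_zero_of_not_finite_selmer (hp2 : p ≠ 2) (C : VariableChange ℚ)
    (V : WeierstrassCurve ℚ) [V.IsElliptic] [V.IsGloballyMinimal]
    (hCV : C • W.quadraticTwist ((-1) ^ (p / 2) * p) = V)
    (hgood : V.HasGoodReductionAtPrime p) (hap : V.frobeniusTrace p = 0)
    {γ : Field.absoluteGaloisGroup ℚ} (hγ : κ.IsTopGenerator γ)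
    (hinf : ¬ Finite ↥(W.selmerGroupPInfty p))
    (D : StrictSignedSelmerDualData W κ ℚ_[p] γ 1)
    [Module.Finite (IwasawaAlgebra p) D.X] (hX : Module.IsTorsion (IwasawaAlgebra p) D.X)
    {g : IwasawaAlgebra p} (hg : D.charIdeal = Ideal.span {g}) :
    PowerSeries.constantCoeff g = 0 := by
  by_contra h0
  haveI hA := EvenControlZero.finite_localPreimage_of_constantCoeff_ne_zero κ W 1 hp2 C V hCV hgood hap
    hγ D hX hg h0
  have hle := EtaBottomLayer.layer_le_localPreimage κ W hp2 C V hCV hgood hap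
  haveI hS0 : Finite ↥(strictSignedSelmerLayer W κ ℚ_[p] 1 0) :=
    Finite.of_equiv _ (AddSubgroup.addSubgroupOfEquivOfLe hle).toEquiv
  have hcard := StrictSignedLayerZero.natCard_strictSignedSelmerLayer_one_zero_eq_selmerGroupPInfty W κ
    (p := p)
  exact hinf (Nat.finite_of_card_ne_zero (hcard ▸ Nat.card_pos.ne'))

/-- **`rank W(ℚ) ≠ 0 ⟹ Sel_{p^∞}(W/ℚ)` is infinite** (corank identity `corank Sel_{p^∞} = rank +
corank Ш[p^∞]`, tree theorem `selmerCorank_eq_mordellWeilRank_add_holds`; a finite group has corank `0`).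
[cite: GreenbergLNM1716, §1 p. 54] -/
theorem not_finite_selmer_of_mordellWeilRank_ne_zero (hr : W.mordellWeilRank ≠ 0) :
    ¬ Finite ↥(W.selmerGroupPInfty p) := fun hfin ↦ by
  haveI := hfin
  have h0 : W.selmerCorank p = 0 := zpCorank_eq_zero_of_finite _ p
  have h := W.selmerCorank_eq_mordellWeilRank_add_holds p
  omega

/-- **Analytic rank `1` ⟹ `Sel_{p^∞}(W/ℚ)` infinite**, granted Gross–Zagier–Kolyvagin (`hGZK`, named fact:
`rank = r_an` for `r_an ≤ 1`). [cite: GreenbergLNM1716, §1 p. 54] -/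
theorem not_finite_selmer_of_analyticRank_eq_one (hGZK : rank_eq_analyticRank_of_analyticRank_le_one)
    (h1 : W.analyticRank = 1) : ¬ Finite ↥(W.selmerGroupPInfty p) :=
  not_finite_selmer_of_mordellWeilRank_ne_zero W (p := p)
    (by rw [(hGZK W h1.le).1, h1]; exact one_ne_zero)

end Twist

/-! ## §3 `η`-side: the road on `X⁺(V/K_∞)^η` -/

section Eta

variable (W : WeierstrassCurve ℚ) [W.IsElliptic] (p : ℕ) [hp : Fact p.Prime]

/-- **`Sel_{p^∞}(W/ℚ)` infinite ⟹ `T ∣ Char(X⁺(V/K_∞)^η)`**: for `W` globally minimal, `p ≥ 5`, `V` a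
globally minimal model of `W^{(p*)}` good at `p` with `a_p(V) = 0`, every `η`-signed plus dual datum `D'` of
`V` (abstract `K₀ = ℚ(μ_p)`, `ηq` the quadratic character, `κ` cyclotomic, `γ ∈ Gal(ℚ̄/K₀)` a topological
generator) which is finitely generated torsion, with `Char(D'.X) = (g)`, has `g(0) = 0`. §2 through ctrl
g4's (D5⁺)⁻¹ (`ConverseControl.exists_strictSignedSelmerDualData_one_of_eta`, same module class / same
characteristic ideal). Unconditional. [cite: Kobayashi2003, §4 p. 8 (X⁺(E/K_∞)^η), Lemma 9.1 (p. 25)]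
[cite: GreenbergLNM1716, §4 Lemma 4.2 (p. 102)] -/
theorem eta_constantCoeff_charGenerator_eq_zero_of_not_finite_selmer
    (V : WeierstrassCurve ℚ) [V.IsElliptic] [V.IsGloballyMinimal] (C : VariableChange ℚ)
    (hp5 : 5 ≤ p) (hCV : C • W.quadraticTwist ((-1) ^ (p / 2) * p) = V)
    (hgood : V.HasGoodReductionAtPrime p) (hap : V.frobeniusTrace p = 0)
    (hinf : ¬ Finite ↥(W.selmerGroupPInfty p))
    (K₀ : Type) [Field K₀] [NumberField K₀] [IsCyclotomicExtension {p} ℚ K₀]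
    [(galRange (K := ℚ) K₀).Normal] (ηq : absoluteGaloisGroup ℚ →* ℤˣ)
    (hηK : ∀ σ ∈ galRange (K := ℚ) K₀, ηq σ = 1) (hη1 : ηq ≠ 1)
    {κ : ZpExtension ℚ p} {γ : absoluteGaloisGroup ℚ} (hκ : κ.IsCyclotomic) (hγ : κ.IsTopGenerator γ)
    (hγK : γ ∈ galRange (K := ℚ) K₀) (D' : EtaSignedSelmerDualData V κ K₀ ℚ_[p] ηq γ 1)
    [Module.Finite (IwasawaAlgebra p) D'.X] (hX' : Module.IsTorsion (IwasawaAlgebra p) D'.X)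
    {g : IwasawaAlgebra p} (hg : D'.charIdeal = Ideal.span {g}) :
    PowerSeries.constantCoeff g = 0 := by
  have hp2 : p ≠ 2 := by omega
  -- the dictionary data at the abstract `K₀ = ℚ(μ_p)` (as in g3's `EtaTamagawaDichotomy`)
  obtain ⟨θ, hθ2⟩ := exists_sq_eq_pStar p K₀ hp2
  have hc : θ ^ 2 = algebraMap ℚ K₀ ((-1) ^ (p / 2) * p) := by
    rw [hθ2, map_mul, map_pow, map_neg, map_one, map_natCast]
  have hθ : θ ∉ Set.range (algebraMap ℚ K₀) := by
    rintro ⟨q, hq⟩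
    apply forall_sq_ne_pStar p q
    apply (algebraMap ℚ K₀).injective
    rw [map_pow, hq, hc]
  have hη := eta_eq_one_iff_smul_rootInClosure p K₀ hθ hc ηq hηK hη1
  have hDloc := localTowerHyp_padic p κ K₀ hκ
  have hκ₀ := kappa_surjOn_galRange_cyclotomic κ K₀
  have hcop := coprime_index_galRange_cyclotomic p K₀
  obtain ⟨D, hfin, htor, hchar, -⟩ :=
    ConverseControl.exists_strictSignedSelmerDualData_one_of_eta W K₀ hθ hc p κ hCV ηq hη ℚ_[p] hDloc hκ₀
      hcop hγK D'
  haveI : Module.Finite (IwasawaAlgebra p) D.X := hfin.mpr inferInstance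
  exact constantCoeff_charGenerator_eq_zero_of_not_finite_selmer κ W hp2 C V hCV hgood hap hγ hinf D
    (htor.mpr hX') (hchar.trans hg)

/-- **THE PRIME-`L`-FUNCTION ROAD at a pair: (C1⁺_η)(V,p) ⟸ `μ(X⁺(V/K_∞)^η) = 0` when `L_p⁺(V,η,X)` is
PRIME and `Sel_{p^∞}(W/ℚ)` is infinite.** `W` globally minimal, `p ≥ 5`, `V` a globally minimal model of
`W^{(p*)}` good at `p` with `a_p(V) = 0`, `Sel_{p^∞}(W/ℚ)` infinite (e.g. analytic rank `1`, §2); DISPLAYED: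
`hprime` — every `Lη` with Kobayashi's plus interpolation property at `η` (for a newform `f` of `V` and the
period ratio `ϖ` of the parity of `η`) is a prime element of `Λ` (analytic INPUT; e.g. `(Lη) = (X)`, next
theorem) — and `hμ` — every characteristic generator of every `η`-datum has unit content (`μ = 0`, verbatim
the skeleton's `EtaMuZeroAt V p`); NAMED facts `h22` (Thm. 2.2η: f.g. torsion) and `h41` (Thm. 4.1η,
rational clause). Then for every `η`-datum `D`: `D.X` is f.g. torsion and `Char(D.X) = (Lη)` — §1's three
lines with `g ∉ Λˣ` from §3's `T ∣ g`. NO leading-term identity, no `p`-adic height, no `BSD_p(W)`, no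
Kitajima–Otsuki, no Poitou–Tate, no image hypothesis. CONDITIONAL on the displayed binders; nothing booked.
[cite: Kobayashi2003, §4 Even main conjecture and Thm. 4.1 first display (p. 8), Thm. 2.2 (p. 5)]
[cite: GreenbergVatsal2000, p. 2 (2)] [cite: Washington1997, §7.1 and §13.1] -/
theorem quadraticBranchPlusEtaMainConjectureAt_of_prime_of_hasUnitContent
    (h22 : Kobayashi2003.thm22_etaSignedSelmerDual_finite_torsion)
    (h41 : Kobayashi2003.thm41_plusEtaCharIdeal_dvd)
    (V : WeierstrassCurve ℚ) [V.IsElliptic] [V.IsGloballyMinimal] (C : VariableChange ℚ)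
    (hp5 : 5 ≤ p) (hCV : C • W.quadraticTwist ((-1) ^ (p / 2) * p) = V)
    (hgood : V.HasGoodReductionAtPrime p) (hap : V.frobeniusTrace p = 0)
    (hinf : ¬ Finite ↥(W.selmerGroupPInfty p))
    (hprime : ∀ {N : ℕ} [NeZero N] {f : CuspForm (Gamma0 N) 2}, IsNewformOf V f →
      ∀ (ϖ : ℚ), (if Even (p / 2) then (ϖ : ℝ) * V.realPeriodRat = plusPeriod f
          else (ϖ : ℝ) * V.imaginaryPeriodRat = minusPeriod f) →
      ∀ (Lη : IwasawaAlgebra p), IsQuadraticBranchPlusLFunction f p ϖ Lη → Prime Lη)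
    (hμ : ∀ (K₀ : Type) [Field K₀] [NumberField K₀] [IsCyclotomicExtension {p} ℚ K₀]
        [(galRange (K := ℚ) K₀).Normal] (ηq : absoluteGaloisGroup ℚ →* ℤˣ),
        (∀ σ ∈ galRange (K := ℚ) K₀, ηq σ = 1) → ηq ≠ 1 →
      ∀ (κ : ZpExtension ℚ p) (γ : absoluteGaloisGroup ℚ),
        κ.IsCyclotomic → κ.IsTopGenerator γ → γ ∈ galRange (K := ℚ) K₀ →
      ∀ (D : EtaSignedSelmerDualData V κ K₀ ℚ_[p] ηq γ 1) (g : IwasawaAlgebra p),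
        D.charIdeal = Ideal.span {g} → HasUnitContent g) :
    QuadraticBranchPlusEtaMainConjectureAt V p := by
  intro K₀ _ _ _ _ ηq hηK hη1 N _ f hp2 hgood' hap' hf ϖ hϖ Lη hL κ γ hκ hγ hγK hγc D
  obtain ⟨hfin, htor⟩ :=
    EtaSignedSelmerDualData.finite_isTorsion_of_thm22 h22 hηK hp2 hgood' hap' hκ hγ hγK D
  refine ⟨hfin, htor, ?_⟩
  -- Thm. 4.1 at `η`, rational clause: `pⁿ·Lη ∈ Char`
  obtain ⟨⟨n, hn⟩, -⟩ := EtaSignedSelmerDualData.thm41_plus_of_facts h22 h41 hηK hη1 hp2 hgood' hap' hf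
    ϖ hϖ Lη hL hκ hγ hγK hγc D
  -- a generator of `Char(X⁺(V/K_∞)^η)`, of unit content by `hμ`, with `g(0) = 0` by the bottom layer
  haveI : D.charIdeal.IsPrincipal := charIdeal_isPrincipal_holds p D.X
  obtain ⟨g, hg⟩ := Submodule.IsPrincipal.principal D.charIdeal
  have hg' : D.charIdeal = Ideal.span {g} := hg
  have hu : HasUnitContent g := hμ K₀ ηq hηK hη1 κ γ hκ hγ hγK D g hg'
  haveI := hfin
  have h0 : PowerSeries.constantCoeff g = 0 :=
    eta_constantCoeff_charGenerator_eq_zero_of_not_finite_selmer W p V C hp5 hCV hgood hap hinf K₀ ηq hηK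
      hη1 hκ hγ hγK D htor hg'
  rw [hg', Ideal.mem_span_singleton] at hn
  have hC : ((p : IwasawaAlgebra p) ^ n : IwasawaAlgebra p) = PowerSeries.C ((p : ℤ_[p]) ^ n) := by
    rw [map_pow, map_natCast]
  rw [hC] at hn
  rw [hg']
  exact span_eq_span_of_prime_of_hasUnitContent_of_dvd (hprime hf ϖ hϖ Lη hL) hu n hn
    (not_isUnit_of_constantCoeff_eq_zero h0)

/-- **The `λ = 1` shape: (C1⁺_η)(V,p) ⟸ `μ(X⁺(V/K_∞)^η) = 0` when `(L_p⁺(V,η,X)) = (X)` and `Sel_{p^∞}(W/ℚ)`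
is infinite.** As `quadraticBranchPlusEtaMainConjectureAt_of_prime_of_hasUnitContent`, the analytic input
displayed as `Ideal.span {Lη} = Ideal.span {X}` — Iwasawa invariants `(λ, μ) = (1, 0)` of the `η`-branch plus
`p`-adic `L`-function together with `L_p⁺(V,η,0) = 0` (PARI's `ellpadiclambdamu` first component on the
branch `ω^{(p−1)/2}`: 254 of the 290 rank-`1` non-onto rows below `5·10⁵`, seat g3's census). Conversely, at
a datum with `Char = (Lη) = (X)` the generator has unit content (`hasUnitContent_of_span_eq_span_X`), so on
these rows the crux IS `μ = 0`. CONDITIONAL; nothing booked.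
[cite: Kobayashi2003, §4 Even main conjecture and Thm. 4.1 first display (p. 8)] [cite: GreenbergVatsal2000, p. 2 (2)] -/
theorem quadraticBranchPlusEtaMainConjectureAt_of_span_eq_span_X_of_hasUnitContent
    (h22 : Kobayashi2003.thm22_etaSignedSelmerDual_finite_torsion)
    (h41 : Kobayashi2003.thm41_plusEtaCharIdeal_dvd)
    (V : WeierstrassCurve ℚ) [V.IsElliptic] [V.IsGloballyMinimal] (C : VariableChange ℚ)
    (hp5 : 5 ≤ p) (hCV : C • W.quadraticTwist ((-1) ^ (p / 2) * p) = V)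
    (hgood : V.HasGoodReductionAtPrime p) (hap : V.frobeniusTrace p = 0)
    (hinf : ¬ Finite ↥(W.selmerGroupPInfty p))
    (hX : ∀ {N : ℕ} [NeZero N] {f : CuspForm (Gamma0 N) 2}, IsNewformOf V f →
      ∀ (ϖ : ℚ), (if Even (p / 2) then (ϖ : ℝ) * V.realPeriodRat = plusPeriod f
          else (ϖ : ℝ) * V.imaginaryPeriodRat = minusPeriod f) →
      ∀ (Lη : IwasawaAlgebra p), IsQuadraticBranchPlusLFunction f p ϖ Lη →
        Ideal.span {Lη} = Ideal.span {(PowerSeries.X : IwasawaAlgebra p)})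
    (hμ : ∀ (K₀ : Type) [Field K₀] [NumberField K₀] [IsCyclotomicExtension {p} ℚ K₀]
        [(galRange (K := ℚ) K₀).Normal] (ηq : absoluteGaloisGroup ℚ →* ℤˣ),
        (∀ σ ∈ galRange (K := ℚ) K₀, ηq σ = 1) → ηq ≠ 1 →
      ∀ (κ : ZpExtension ℚ p) (γ : absoluteGaloisGroup ℚ),
        κ.IsCyclotomic → κ.IsTopGenerator γ → γ ∈ galRange (K := ℚ) K₀ →
      ∀ (D : EtaSignedSelmerDualData V κ K₀ ℚ_[p] ηq γ 1) (g : IwasawaAlgebra p),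
        D.charIdeal = Ideal.span {g} → HasUnitContent g) :
    QuadraticBranchPlusEtaMainConjectureAt V p := by
  intro K₀ _ _ _ _ ηq hηK hη1 N _ f hp2 hgood' hap' hf ϖ hϖ Lη hL κ γ hκ hγ hγK hγc D
  obtain ⟨hfin, htor⟩ :=
    EtaSignedSelmerDualData.finite_isTorsion_of_thm22 h22 hηK hp2 hgood' hap' hκ hγ hγK D
  refine ⟨hfin, htor, ?_⟩
  obtain ⟨⟨n, hn⟩, -⟩ := EtaSignedSelmerDualData.thm41_plus_of_facts h22 h41 hηK hη1 hp2 hgood' hap' hf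
    ϖ hϖ Lη hL hκ hγ hγK hγc D
  have hC : ((p : IwasawaAlgebra p) ^ n : IwasawaAlgebra p) = PowerSeries.C ((p : ℤ_[p]) ^ n) := by
    rw [map_pow, map_natCast]
  rw [hC] at hn
  haveI := hfin
  -- at this datum the main conjecture IS `μ = 0` (§1), and `μ = 0` is `hμ`
  exact (ideal_eq_span_iff_forall_hasUnitContent_of_span_eq_span_X (charIdeal_isPrincipal_holds p D.X)
    (hX hf ϖ hϖ Lη hL) hn (fun g hg ↦
      eta_constantCoeff_charGenerator_eq_zero_of_not_finite_selmer W p V C hp5 hCV hgood hap hinf K₀ ηq hηK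
        hη1 hκ hγ hγK D htor hg)).mpr (fun g hg ↦ hμ K₀ ηq hηK hη1 κ γ hκ hγ hγK D g hg)

/-- **Stub-shaped ∀-form for the planner (rank-`1` rows of crux 19606).** Granted Thm. 2.2η, Thm. 4.1η
(rational clause) and GZK (named facts): for every `p ≥ 5` and every globally minimal model `V` of `W^{(p*)}`
(`W` globally minimal) good at `p` with `a_p(V) = 0` and `r_an(W) = 1`, IF `(L_p⁺(V,η,X)) = (X)` (analytic
input, displayed) and `μ(X⁺(V/K_∞)^η) = 0` (displayed — the rank-`1` twin of `stub_etaMC_r0_mu`), THEN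
(C1⁺_η)(V,p). So on its rank-`1` rows with `λ_an = 1` crux 19606 IS «`μ(X⁺(V/K_∞)^η) = 0`» — as on its
rank-`0` rows (skeleton v3), but with NO L₀ / bsd.S28 / Poitou–Tate / Kitajima–Otsuki / 19116 input. The
`¬ onto` binder of the crux is not used (image-free). CONDITIONAL; nothing booked.
[cite: Kobayashi2003, §4 Even main conjecture and Thm. 4.1 first display (p. 8), Thm. 2.2 (p. 5)]
[cite: GreenbergVatsal2000, p. 2 (2)] [cite: GreenbergLNM1716, §1 p. 54, §4 Lemma 4.2 (p. 102)] -/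
theorem etaMC_rankOneRows_of_mu_eq_zero_of_span_eq_span_X
    (h22 : Kobayashi2003.thm22_etaSignedSelmerDual_finite_torsion)
    (h41 : Kobayashi2003.thm41_plusEtaCharIdeal_dvd)
    (hGZK : rank_eq_analyticRank_of_analyticRank_le_one) :
    ∀ (V : WeierstrassCurve ℚ) [V.IsElliptic] [V.IsGloballyMinimal] (W : WeierstrassCurve ℚ) [W.IsElliptic]
      [W.IsGloballyMinimal] (C : VariableChange ℚ) (p : ℕ) [Fact p.Prime],
      5 ≤ p → C • W.quadraticTwist ((-1) ^ (p / 2) * p) = V →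
      V.HasGoodReductionAtPrime p → V.frobeniusTrace p = 0 → W.analyticRank = 1 →
      (∀ {N : ℕ} [NeZero N] {f : CuspForm (Gamma0 N) 2}, IsNewformOf V f →
        ∀ (ϖ : ℚ), (if Even (p / 2) then (ϖ : ℝ) * V.realPeriodRat = plusPeriod f
            else (ϖ : ℝ) * V.imaginaryPeriodRat = minusPeriod f) →
        ∀ (Lη : IwasawaAlgebra p), IsQuadraticBranchPlusLFunction f p ϖ Lη →
          Ideal.span {Lη} = Ideal.span {(PowerSeries.X : IwasawaAlgebra p)}) →
      (∀ (K₀ : Type) [Field K₀] [NumberField K₀] [IsCyclotomicExtension {p} ℚ K₀]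
          [(galRange (K := ℚ) K₀).Normal] (ηq : absoluteGaloisGroup ℚ →* ℤˣ),
          (∀ σ ∈ galRange (K := ℚ) K₀, ηq σ = 1) → ηq ≠ 1 →
        ∀ (κ : ZpExtension ℚ p) (γ : absoluteGaloisGroup ℚ),
          κ.IsCyclotomic → κ.IsTopGenerator γ → γ ∈ galRange (K := ℚ) K₀ →
        ∀ (D : EtaSignedSelmerDualData V κ K₀ ℚ_[p] ηq γ 1) (g : IwasawaAlgebra p),
          D.charIdeal = Ideal.span {g} → HasUnitContent g) →
      QuadraticBranchPlusEtaMainConjectureAt V p := by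
  intro V _ _ W _ _ C p _ hp5 hCV hgood hap h1 hX hμ
  exact quadraticBranchPlusEtaMainConjectureAt_of_span_eq_span_X_of_hasUnitContent W p h22 h41 V C hp5 hCV
    hgood hap (not_finite_selmer_of_analyticRank_eq_one W (p := p) hGZK h1) hX hμ

end Eta

end EtaPrimeRoad

end Summit.BirchSwinnertonDyer.BirchSwinnertonDyer.Theorems

end
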